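import Literature.AlgebraicGeometry.HodgeTheory.CMHodgeGroupCentreWeil
import HarnessLib

/-!
# The centre of `Lie Hg` for a CM field with two places of UNEQUAL Hodge weight (the quartic CM pattern
# `(3,0)+(2,1)`): the central idempotents lie in `𝔤_ℂ` (Moonen–Zarhin 1999 §1–2, Ribet 1983 Thm. 0)

Family `hodge`, layer `Literature/AlgebraicGeometry/HodgeTheory` (cell `pub-hodgeav-hg6`, req-37 (A) Q2b, TABLE X ROW 10 —
`End⁰ = E` a quartic CM field, `dim_E H¹ = 3`, pattern `(3,0)+(2,1)` — brick (c) of the eng-5 g6 plan; companion of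
`CMHodgeGroupCentre` (`centre_of_single`) and `CMHodgeGroupCentreWeil` (`centre_of_pair`)). UNCONDITIONAL; theorems
only, no definition, no named fact, no `sorry`. HONEST FRAMING of that cell: HC / HC_AV / HC_CM / H2 NOT proved — this file
is linear algebra of polarized weight-one `ℚ`-Hodge structures.

SETTING as in `CMThetaCentre.centre_or_exists_skew`: `E = End_Hdg(V) = ℚ[φ]` of dimension `2|ι|`, every non-zero
element invertible, `φ† ≠ φ`, a CM type `μ : ι → ℂ` with blocks of dimension `n₀`, an admissible `𝔤 ∋ Θ`, the LIFT
property.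
* **`CMThetaCentre.centre_of_unequal_pair`** — CENTRE for `|ι| ≤ 2` places `k₀ ≠ k₁` of UNEQUAL weights
  `t_k = dim W_{μ k}^{1,0} − dim W_{μ k}^{0,1}`, i.e. `t_{k₀}² ≠ t_{k₁}²` (row 10: `(t_{k₀}, t_{k₁}) = (±3, ±1)`), WITHOUT any
  Weil-type hypothesis. PROOF (Galois-free): the obstruction `y ∈ E⁻ ∖ 0` of `centre_or_exists_skew` satisfies
  `σ_{k₀}(y) t_{k₀} + σ_{k₁}(y) t_{k₁} = 0`; `u = y² ∈ E` acts on the `2n₀` adapted basis vectors over the place `k` by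
  `σ_k(y)²` (`−σ_k` on the conjugate block, by skewness), so `Tr_ℚ(u) = 2n₀(σ_{k₀}² + σ_{k₁}²)` while
  `σ_{k₁}² t_{k₁}² = σ_{k₀}² t_{k₀}²`: hence `σ_{k₀}(y)² = Tr_ℚ(u) t_{k₁}² / (2n₀ (t_{k₀}² + t_{k₁}²)) ∈ ℚ`, so `u` is the
  rational scalar `σ_{k₀}²` (`CMArith.eq_smul_one_of_apply_eq_smul`), so `σ_{k₁}² = σ_{k₀}²`, so (unequal weights)
  `σ_{k₀}(y) = 0` — impossible for `y ≠ 0` in the field `E` (`CMArith.apply_ne_zero`).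
(«For a quartic CM field and signature `{(3,0),(2,1)}` the reflex norm is onto: `Hg ⊇ U_E(1) = Z(U_E)`»; for the equal-weight
patterns see `centre_of_pair`, where the Weil-type members are the genuine exception.)

## References
* [MoonenZarhin1999LowDim] B. Moonen, Yu. Zarhin, Math. Ann. 315 (1999), §1 (1.8), §2 (2.3).
* [Ribet1983] K. A. Ribet, Amer. J. Math. 105 (1983), Thm. 0 and §3.
* [Deligne1982HodgeCycles] P. Deligne, LNM 900 (1982), I §3 Prop. 3.4, §4 (p. 30).
-/

noncomputable section

open scoped TensorProduct
open Module

namespace Literature.AlgebraicGeometry.Motives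

namespace HodgeStructure

universe u

variable {V : Type u} [AddCommGroup V] [Module ℚ V] {n : ℤ}

/-- Rational scalars act on `V_ℂ` through `ℚ ⊆ ℂ`. [folklore] -/
private theorem CMUnequal.ratCast_smul (q : ℚ) (z : ℂ ⊗[ℚ] V) : (q : ℂ) • z = q • z := by
  rw [← algebraMap_smul ℂ q z, eq_ratCast]

/-- **CENTRE FOR TWO PLACES OF UNEQUAL WEIGHT** (see the module docstring): `|ι| ≤ 2`, places `k₀ ≠ k₁` with
`(dim W_{μ k₀}^{1,0} − dim W_{μ k₀}^{0,1})² ≠ (dim W_{μ k₁}^{1,0} − dim W_{μ k₁}^{0,1})²`; then for every `k` some `C ∈ 𝔤_ℂ` is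
`1` on `W_{μ k}` and `0` on the other block — with LIFT, `𝔤_ℂ ⊇ 𝔲_E(V,ψ)_ℂ` (`CMThetaSocket.mem_spanC_of_lift_of_centre`).
Covers the cell's row-10 pattern `(3,0)+(2,1)` unconditionally. [cite: MoonenZarhin1999LowDim, §2 (2.3)] [cite: Ribet1983, Thm. 0] -/
theorem CMThetaCentre.centre_of_unequal_pair [Module.Finite ℚ V] [HodgeTensorFacts.{u, u}] {ι : Type} [Fintype ι]
    [DecidableEq ι] (hι : Fintype.card ι ≤ 2)
    (H : HodgeStructure V n) (hn : n = 1) (heff : H.IsEffective) (ψ : H.Polarization)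
    {φ : Module.End ℚ V} (hφE : φ ∈ H.endAlg) {m : ℕ} (hE : ∀ a ∈ H.endAlg, ∃ q : Fin m → ℚ, a = ∑ k, q k • φ ^ (k : ℕ))
    (hEdim : Module.finrank ℚ H.endAlg = 2 * Fintype.card ι)
    (hdiv : ∀ a ∈ H.endAlg, a ≠ 0 → ∃ b : Module.End ℚ V, b * a = 1) (hφadj : ψ.adjoint φ ≠ φ)
    (μ : ι → ℂ) (hinj : Function.Injective μ) (hdist : ∀ k k', μ k' ≠ starRingEnd ℂ (μ k)) {n₀ : ℕ} (hn₀ : n₀ ≠ 0)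
    (hrank : ∀ k, Module.finrank ℂ ↥(Module.End.eigenspace (φ.baseChange ℂ) (μ k) ⊓ H.piece 1 0) +
      Module.finrank ℂ ↥(Module.End.eigenspace (φ.baseChange ℂ) (μ k) ⊓ H.piece 0 1) = n₀)
    (htop : (⨆ kt : ι × Fin 2, Module.End.eigenspace (φ.baseChange ℂ)
      (if kt.2 = 0 then μ kt.1 else starRingEnd ℂ (μ kt.1))) = ⊤)
    (𝔤 : Submodule ℚ (Module.End ℚ V))
    (hcomm : ∀ X ∈ 𝔤, ∀ a : H.endAlg, X * (a : Module.End ℚ V) = (a : Module.End ℚ V) * X)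
    (hskew : ∀ X ∈ 𝔤, ∀ v w, ψ.form (X v) w + ψ.form v (X w) = 0)
    {Θ : Module.End ℂ (ℂ ⊗[ℚ] V)} (hΘ : ∀ p, ∀ x ∈ H.piece p (n - p), Θ x = ((2 * p - n : ℤ) : ℂ) • x)
    (hΘ𝔤 : Θ ∈ spanC 𝔤)
    (hlift : ∀ k, ∀ Z : Module.End ℂ ↥(Module.End.eigenspace (φ.baseChange ℂ) (μ k)),
      LinearMap.trace ℂ _ Z = 0 → ∃ X ∈ spanC 𝔤,
        (∀ w : ↥(Module.End.eigenspace (φ.baseChange ℂ) (μ k)), X w = Z w) ∧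
        ∀ j, j ≠ k → ∀ w ∈ Module.End.eigenspace (φ.baseChange ℂ) (μ j), X w = 0)
    (k₀ k₁ : ι) (hk : k₀ ≠ k₁)
    (ht : ((Module.finrank ℂ ↥(Module.End.eigenspace (φ.baseChange ℂ) (μ k₀) ⊓ H.piece 1 0) : ℤ) -
        Module.finrank ℂ ↥(Module.End.eigenspace (φ.baseChange ℂ) (μ k₀) ⊓ H.piece 0 1)) ^ 2 ≠
      ((Module.finrank ℂ ↥(Module.End.eigenspace (φ.baseChange ℂ) (μ k₁) ⊓ H.piece 1 0) : ℤ) -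
        Module.finrank ℂ ↥(Module.End.eigenspace (φ.baseChange ℂ) (μ k₁) ⊓ H.piece 0 1)) ^ 2) :
    ∀ k, ∃ C ∈ spanC 𝔤, (∀ w ∈ Module.End.eigenspace (φ.baseChange ℂ) (μ k), C w = w) ∧
      ∀ j, j ≠ k → ∀ w ∈ Module.End.eigenspace (φ.baseChange ℂ) (μ j), C w = 0 := by
  classical
  rcases CMThetaCentre.centre_or_exists_skew H hn heff ψ hφE hE hEdim hdiv hφadj μ hinj hdist hn₀ hrank htop 𝔤 hcomm
    hskew hΘ hΘ𝔤 hlift with h | ⟨y, hyE, hy0, hyskew, σ, hσ, hsum⟩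
  · exact h
  exfalso
  haveI : Module.Free ℚ V := Module.Free.of_divisionRing ℚ V
  set F := φ.baseChange ℂ with hF
  -- the integer weights `z k = dim W^{1,0} − dim W^{0,1}` and their complex images `t k`
  set z : ι → ℤ := fun k => ((Module.finrank ℂ ↥(Module.End.eigenspace F (μ k) ⊓ H.piece 1 0) : ℤ) -
    (Module.finrank ℂ ↥(Module.End.eigenspace F (μ k) ⊓ H.piece 0 1) : ℤ)) with hzdef
  set t : ι → ℂ := fun k => ((Module.finrank ℂ ↥(Module.End.eigenspace F (μ k) ⊓ H.piece 1 0) : ℂ) -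
    (Module.finrank ℂ ↥(Module.End.eigenspace F (μ k) ⊓ H.piece 0 1) : ℂ)) with htdef
  have htz : ∀ k, t k = ((z k : ℤ) : ℂ) := fun k => by simp only [htdef, hzdef, Int.cast_sub, Int.cast_natCast]
  have hz : z k₀ ^ 2 ≠ z k₁ ^ 2 := ht
  have hsum' : ∑ k, σ k * t k = 0 := hsum
  -- `ι = {k₀, k₁}`
  have huniv : ∀ k, k = k₀ ∨ k = k₁ := by
    intro k
    by_contra hne
    rw [not_or] at hne
    have h3 : ({k, k₀, k₁} : Finset ι).card = 3 := by
      rw [Finset.card_insert_of_notMem (by simp [hne.1, hne.2]), Finset.card_insert_of_notMem (by simp [hk]),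
        Finset.card_singleton]
    have hle : ({k, k₀, k₁} : Finset ι).card ≤ Fintype.card ι := Finset.card_le_univ _
    omega
  -- the relation `σ k₀ t k₀ + σ k₁ t k₁ = 0`
  have hrel : σ k₀ * t k₀ + σ k₁ * t k₁ = 0 := by
    rw [← hsum', Finset.sum_eq_add k₀ k₁ hk (fun k _ hk' => (huniv k).elim (fun e => absurd e hk'.1)
      (fun e => absurd e hk'.2)) (fun h => absurd (Finset.mem_univ k₀) h) (fun h => absurd (Finset.mem_univ k₁) h)]
  have hsq : σ k₁ ^ 2 * t k₁ ^ 2 = σ k₀ ^ 2 * t k₀ ^ 2 := by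
    have h1 : (σ k₁ * t k₁) ^ 2 = (σ k₀ * t k₀) ^ 2 := by
      rw [show σ k₁ * t k₁ = -(σ k₀ * t k₀) from eq_neg_of_add_eq_zero_right hrel, neg_sq]
    rw [mul_pow, mul_pow] at h1
    exact h1
  -- `y_ℂ` commutes with `φ_ℂ` and is skew
  have hEcomm : ∀ a ∈ H.endAlg, ∀ b ∈ H.endAlg, a * b = b * a := fun a ha b hb =>
    CMThetaCentre.mul_comm_of_hE H hE ha hb
  have hyφ : y.baseChange ℂ * F = F * y.baseChange ℂ := by
    rw [hF, ← LinearMap.baseChange_mul, hEcomm y hyE φ hφE, LinearMap.baseChange_mul]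
  have hyskewC := CMThetaCentre.baseChange_skew H ψ hyskew
  -- the adapted dual basis; `y_ℂ` is `σ k` on the `(k,0)`- and `−σ k` on the `(k,1)`-vectors
  obtain ⟨cb, κ, hcbW, hcbW', -, -, hdual, hiso⟩ :=
    CMTheta.exists_adaptedDualBasis H hn heff ψ hφE hE μ hinj hdist hrank htop
  have hfin : ∀ k, Module.finrank ℂ ↥(Module.End.eigenspace F (μ k)) = n₀ := fun k => by
    rw [hF, CMTheta.finrank_eigenspace_eq_add H hn heff hφE, hrank k]
  have hfin' : ∀ k, Module.finrank ℂ ↥(Module.End.eigenspace F (starRingEnd ℂ (μ k))) = n₀ := fun k => by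
    rw [← hfin k, hF, ← finrank_eigenspace_baseChange_conj_eq starRingAut φ (μ k), starRingAut_apply,
      starRingEnd_apply]
  have he1 : ∀ k : ι, Function.Injective (fun j : Fin n₀ => (((k, (1 : Fin 2)), j) : (ι × Fin 2) × Fin n₀)) :=
    fun k j j' h => by simpa using h
  have hW'span : ∀ k, Module.End.eigenspace F (starRingEnd ℂ (μ k)) =
      Submodule.span ℂ (Set.range (cb ∘ fun j : Fin n₀ => ((k, (1 : Fin 2)), j))) :=
    fun k => CMArith.eq_span_of_basis cb _ (he1 k) _ (hcbW' k) (hfin' k)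
  have hy0v : ∀ k j, y.baseChange ℂ (cb ((k, 0), j)) = σ k • cb ((k, 0), j) := fun k j => hσ k _ (hcbW k j)
  have hy1v : ∀ k j, y.baseChange ℂ (cb ((k, 1), j)) = -(σ k • cb ((k, 1), j)) :=
    CMArith.apply_eq_neg_smul_of_skew cb (ψ.form.baseChange ℂ) hdual hiso _ σ hy0v hyskewC (fun k j => by
      rw [← hW'span k]
      exact UnitaryTheta.apply_mem_eigenspace_of_commute hyφ (hcbW' k j))
  -- `u = y²` acts on `cb (kt, j)` by `σ kt.1 ²`
  have huE : y * y ∈ H.endAlg := H.endAlg.mul_mem hyE hyE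
  set s : (ι × Fin 2) × Fin n₀ → ℂ := fun i => σ i.1.1 ^ 2 with hsdef
  have hu : ∀ i, (y * y).baseChange ℂ (cb i) = s i • cb i := by
    rintro ⟨⟨k, r⟩, j⟩
    rw [LinearMap.baseChange_mul, Module.End.mul_apply]
    rcases Fin.exists_fin_two.1 ⟨r, rfl⟩ with h | h <;> rw [h]
    · rw [hy0v, map_smul, hy0v, smul_smul]
      simp only [hsdef, sq]
    · rw [hy1v, map_neg, map_smul, hy1v, smul_neg, neg_neg, smul_smul]
      simp only [hsdef, sq]
  -- the rational trace: `Tr_ℚ(y²) = 2 n₀ (σ k₀ ² + σ k₁ ²)`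
  set a := σ k₀ ^ 2 with hadef
  set c := σ k₁ ^ 2 with hcdef
  set r : ℚ := LinearMap.trace ℚ V (y * y) with hrdef
  have htr : (r : ℂ) = 2 * n₀ * (a + c) := by
    rw [hrdef, ← eq_ratCast (algebraMap ℚ ℂ), ← LinearMap.trace_baseChange, CMArith.trace_eq_sum_of_apply_basis cb _ s hu,
      Fintype.sum_prod_type, Fintype.sum_prod_type]
    have hinner : ∀ k : ι, ∑ r : Fin 2, ∑ j : Fin n₀, s ((k, r), j) = 2 * n₀ * σ k ^ 2 := fun k => by
      simp only [hsdef, Finset.sum_const, Finset.card_univ, Fintype.card_fin, nsmul_eq_mul, Nat.cast_ofNat]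
      ring
    rw [Finset.sum_congr rfl fun k _ => hinner k, Finset.sum_eq_add k₀ k₁ hk (fun k _ hk' => (huniv k).elim
      (fun e => absurd e hk'.1) (fun e => absurd e hk'.2)) (fun h => absurd (Finset.mem_univ k₀) h)
      (fun h => absurd (Finset.mem_univ k₁) h)]
    rw [hadef, hcdef]
    ring
  -- `a` is rational
  have hzz : ((z k₀ ^ 2 + z k₁ ^ 2 : ℤ) : ℂ) ≠ 0 := by
    have hpos : 0 < z k₀ ^ 2 + z k₁ ^ 2 := by
      rcases lt_or_ge 0 (z k₀ ^ 2) with h0 | h0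
      · exact lt_add_of_pos_of_le h0 (sq_nonneg _)
      · have h00 : z k₀ ^ 2 = 0 := le_antisymm h0 (sq_nonneg _)
        have h1 : z k₁ ^ 2 ≠ 0 := fun h => hz (h00.trans h.symm)
        exact lt_add_of_le_of_pos (sq_nonneg _) (lt_of_le_of_ne (sq_nonneg _) (Ne.symm h1))
    exact_mod_cast hpos.ne'
  have hn₀C : (n₀ : ℂ) ≠ 0 := Nat.cast_ne_zero.2 hn₀
  have hca : c * ((z k₁ : ℤ) : ℂ) ^ 2 = a * ((z k₀ : ℤ) : ℂ) ^ 2 := by rw [hcdef, hadef, ← htz, ← htz]; exact hsq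
  have haq : a = (((r * (z k₁ ^ 2 : ℤ)) / (2 * n₀ * (z k₀ ^ 2 + z k₁ ^ 2 : ℤ)) : ℚ) : ℂ) := by
    have hden : (2 : ℂ) * n₀ * ((z k₀ ^ 2 + z k₁ ^ 2 : ℤ) : ℂ) ≠ 0 :=
      mul_ne_zero (mul_ne_zero two_ne_zero hn₀C) hzz
    push_cast at hden ⊢
    rw [eq_div_iff hden]
    linear_combination (-((z k₁ : ℂ) ^ 2)) * htr + (-(2 * (n₀ : ℂ))) * hca
  -- hence `y² = a · 1`, so `c = a`
  set j₀ : Fin n₀ := ⟨0, Nat.pos_of_ne_zero hn₀⟩ with hj₀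
  have hu1 : y * y = ((r * (z k₁ ^ 2 : ℤ)) / (2 * n₀ * (z k₀ ^ 2 + z k₁ ^ 2 : ℤ)) : ℚ) • 1 :=
    CMArith.eq_smul_one_of_apply_eq_smul H hdiv huE (cb.ne_zero ((k₀, 0), j₀)) (by rw [hu, hsdef]; simp only; rw [← hadef, haq])
  have hcaeq : c = a := by
    have h := hu ((k₁, 0), j₀)
    rw [hu1, LinearMap.baseChange_smul, LinearMap.smul_apply, LinearMap.baseChange_one, Module.End.one_apply,
      ← CMUnequal.ratCast_smul, ← haq] at h
    have h' : a = s ((k₁, 0), j₀) := smul_left_injective ℂ (cb.ne_zero _) h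
    rw [h', hsdef]
  -- unequal weights force `a = 0`, i.e. `σ k₀ = 0`: contradiction
  have ha0 : a = 0 := by
    rw [hcaeq] at hca
    have h : a * (((z k₁ : ℤ) : ℂ) ^ 2 - ((z k₀ : ℤ) : ℂ) ^ 2) = 0 := by rw [mul_sub, hca, sub_self]
    refine (mul_eq_zero.1 h).resolve_right (sub_ne_zero.2 fun h' => hz ?_)
    exact_mod_cast h'.symm
  have hσ0 : σ k₀ = 0 := pow_eq_zero_iff two_ne_zero |>.1 (hadef ▸ ha0)
  exact CMArith.apply_ne_zero H hdiv hyE hy0 (cb.ne_zero ((k₀, 0), j₀)) (by rw [hy0v, hσ0, zero_smul])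

end HodgeStructure

end Literature.AlgebraicGeometry.Motives
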